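import Summits.AtomisticToContinuum.HydrodynamicLimit.Theorems.OneFlightGossipEngineClampedTransferDockOfInputs
import Summits.AtomisticToContinuum.HydrodynamicLimit.Theorems.OneFlightGossipEngineClampedTransferDockSeet
import HarnessLib

/-!
# Skeleton of line `Sketch` (card `superexp-tails-small-tilt-band`) for the crux `ClampedTransferDock`
# (stmt-AtomisticToContinuum-17615, rev 29, DSC-free) — continuation lead prover-line-stmt-AtomisticToContinuum-17615-c1-0, v6 (cycle 3)

Crux: `Summit.AtomisticToContinuum.HydrodynamicLimit.Theses.OneFlightGossipEngine.ClampedTransferDock :=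
  KineticCurrentsLDAlongFamilies → CollisionActivityTails → EnergyCurrentTails → _root_.HydrodynamicLimit`.

v6 = v5 (lead 17615-0, cycle 2: four plumbing stubs landed p136014 p137576 p138311 p139114 p139514, conditional closing
`ClampedTransferDockSketch.clampedTransferDock_of_inputs` landed p140743, SEET partials p141132) with the four remaining open stubs
RE-TYPED AS THE ROUTE DECLS OF THE ITEMS THE PLANNER FILED FOR THEM (route rev 32, judge-repair 2026-08-17):

| stub | v5 signature (Theorems-level def) | v6 signature = filed route item |
|---|---|---|
| `stub_seet` | `ClampedTransferDockCubicRate.SuperExponentialEnergyTails` | `Theses.OneFlightGossipEngine.SuperExponentialEnergyTails` (stmt-17701, crux r7) |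
| `stub_bandCoherenceLD` | `ClampedTransferDockCubicRate.BandCoherenceLDFamily` | `Theses.OneFlightGossipEngine.BandCoherenceLDAlongFamilies` (stmt-17700, crux r5) |
| `stub_localClampedTransferLD` | `HydroLimitInBandOfHeart.LocalClampedTransferWindowLDFamily` | `Theses.OneFlightGossipEngine.LocalClampedTransferLDAlongFamilies` (stmt-17691, crux r4) |
| `stub_energyActivityTails` | `HydroLimitInBandOfHeart.CollisionEnergyActivityTails` | `Theses.OneFlightGossipEngine.EnergyActivityTails` (stmt-17703, crux r8) |

Each pair is the same term (the four `Iff.rfl` below are the kernel check of the planner's "byte-identical" claim), so the landed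
conditional closing consumes the route items unchanged (`clampedTransferDock_of_routeItems`, sorry-free), and the same composition with
ECT discharged by the landed `ClampedTransferDockSeet.seet_imp_energyCurrentTails` (SEET ⇒ ECT at rate one) is the new binder of
`closes`, `Theses.OneFlightGossipEngine.ClampedTransferDockOfInputs` (stmt-17733) — `clampedTransferDockOfInputs_of_routeItems`,
sorry-free. Landed copy of §2: `Theorems/OneFlightGossipEngineClampedTransferDockOfRouteItems.lean`.

COMPOSITION (`ClampedTransferDock_of`, sorry-free modulo the four `stub_*`): Yau's relative-entropy clock along the explicit reference
family `a_s = ρ_s Rf(σ³ρ_s)` (the shared one-window HEART), re-joined at the landed `GronwallCoreInBand → relEntropyVanishingInBand →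
HydroLimitInBand ≡ HydrodynamicLimit` (`Iff.rfl`, re-typed conjunct D-0032); the line re-threads the suprathermal cubic channel at a
RATE (band `(K⋆, K₁]` paid inside the Grönwall by the running entropy at tilt `(8 Θ̄ K₁)⁻¹` — reference-law input stmt-17700; top `> K₁`
by the true-law super-exponential cubic tails stmt-17701), D-shape ledger `∀ δ ∃ K ∃ ε (4(1+t) ε e^{2Kt} ≤ δ)`; children (iii) stmt-17691
and (iv) stmt-17703 are consumed verbatim by the transfer clamp / window continuity.

STUBS OPEN (4, registered, all conjecture-grade and all FILED as cruxes of the route): `stub_seet` (17701), `stub_bandCoherenceLD`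
(17700), `stub_localClampedTransferLD` (17691), `stub_energyActivityTails` (17703). Nothing else is open: the line is closed modulo
exactly these four items.
-/

noncomputable section

namespace Summit.AtomisticToContinuum.HydrodynamicLimit.Cruxes.ClampedTransferDock.SketchLine

open Summit.AtomisticToContinuum.HydrodynamicLimit.Theses
open Summit.AtomisticToContinuum.HydrodynamicLimit.Theses.OneFlightGossipEngine
open Summit.AtomisticToContinuum.HydrodynamicLimit.Theorems

/-! ## §1 Stubs (the four conjecture-grade inputs, typed as the filed route items) -/

/-- **`stub_seet`** — SEET, the filed crux stmt-AtomisticToContinuum-17701 (true law, fixed-time marginals; reduced to the catalogued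
barrier hypothesis `Literature.Barriers.AtomisticToContinuum.HighMomentumCutoff` and proved at `s = 0` in
`Theorems/…ClampedTransferDockSeet.lean`). -/
theorem stub_seet : Theses.OneFlightGossipEngine.SuperExponentialEnergyTails := by
  sorry

/-- **`stub_bandCoherenceLD`** — the reference-law band exponential moment at tilt `(8 Θ̄ K₁)⁻¹` along families, the filed crux
stmt-AtomisticToContinuum-17700. -/
theorem stub_bandCoherenceLD : Theses.OneFlightGossipEngine.BandCoherenceLDAlongFamilies := by
  sorry

/-- **`stub_localClampedTransferLD`** — child (iii), the local transfer-clamped collisional window LD along families, the filed crux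
stmt-AtomisticToContinuum-17691. -/
theorem stub_localClampedTransferLD : Theses.OneFlightGossipEngine.LocalClampedTransferLDAlongFamilies := by
  sorry

/-- **`stub_energyActivityTails`** — child (iv), the energy-activity twin of CAT, the filed crux stmt-AtomisticToContinuum-17703. -/
theorem stub_energyActivityTails : Theses.OneFlightGossipEngine.EnergyActivityTails := by
  sorry

/-! ## §2 The filed route items ARE the line's inputs (kernel check of "byte-identical") -/

/-- stmt-17701 is, as a term, the line's SEET. -/
theorem superExponentialEnergyTails_iff :
    Theses.OneFlightGossipEngine.SuperExponentialEnergyTails ↔ ClampedTransferDockCubicRate.SuperExponentialEnergyTails :=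
  Iff.rfl

/-- stmt-17700 is, as a term, the line's `BandCoherenceLDFamily`. -/
theorem bandCoherenceLDAlongFamilies_iff :
    Theses.OneFlightGossipEngine.BandCoherenceLDAlongFamilies ↔ ClampedTransferDockCubicRate.BandCoherenceLDFamily :=
  Iff.rfl

/-- stmt-17691 is, as a term, the heart's child (iii) `LocalClampedTransferWindowLDFamily`. -/
theorem localClampedTransferLDAlongFamilies_iff :
    Theses.OneFlightGossipEngine.LocalClampedTransferLDAlongFamilies ↔ HydroLimitInBandOfHeart.LocalClampedTransferWindowLDFamily :=
  Iff.rfl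

/-- stmt-17703 is, as a term, the heart's child (iv) `CollisionEnergyActivityTails`. -/
theorem energyActivityTails_iff :
    Theses.OneFlightGossipEngine.EnergyActivityTails ↔ HydroLimitInBandOfHeart.CollisionEnergyActivityTails :=
  Iff.rfl

/-- **The dock from the four filed route items** (the landed conditional closing `clampedTransferDock_of_inputs`, p140743, transported
along the four identities above). -/
theorem clampedTransferDock_of_routeItems (hS : Theses.OneFlightGossipEngine.SuperExponentialEnergyTails)
    (hB : Theses.OneFlightGossipEngine.BandCoherenceLDAlongFamilies)
    (h₃ : Theses.OneFlightGossipEngine.LocalClampedTransferLDAlongFamilies)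
    (h₄ : Theses.OneFlightGossipEngine.EnergyActivityTails) : ClampedTransferDock :=
  ClampedTransferDockSketch.clampedTransferDock_of_inputs (superExponentialEnergyTails_iff.mp hS)
    (bandCoherenceLDAlongFamilies_iff.mp hB) (localClampedTransferLDAlongFamilies_iff.mp h₃) (energyActivityTails_iff.mp h₄)

/-- **The new binder of `closes` (stmt-AtomisticToContinuum-17733) from the same composition**, ECT discharged by SEET at rate one
(`ClampedTransferDockSeet.seet_imp_energyCurrentTails`, p141132). -/
theorem clampedTransferDockOfInputs_of_routeItems : Theses.OneFlightGossipEngine.ClampedTransferDockOfInputs :=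
  fun hS hB h₃ h₄ hK h₇ =>
    clampedTransferDock_of_routeItems hS hB h₃ h₄ hK h₇
      (ClampedTransferDockSeet.seet_imp_energyCurrentTails (superExponentialEnergyTails_iff.mp hS))

/-! ## §3 Composition: the crux BY NAME -/

/-- **The crux from the four remaining stubs (v6).** -/
theorem ClampedTransferDock_of : ClampedTransferDock :=
  clampedTransferDock_of_routeItems stub_seet stub_bandCoherenceLD stub_localClampedTransferLD stub_energyActivityTails

end Summit.AtomisticToContinuum.HydrodynamicLimit.Cruxes.ClampedTransferDock.SketchLine

end
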